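import Mathlib
import Summits.RiemannHypothesis.RiemannHypothesis.Theorems.WeilFarFloorBoxEnvelope
import Summits.RiemannHypothesis.RiemannHypothesis.Theorems.WeilFarFloorModulusClassRH
import Summits.RiemannHypothesis.RiemannHypothesis.Theorems.WeilFarFloorCoshProfileEnergy
import Summits.RiemannHypothesis.RiemannHypothesis.Theorems.WeilFarFloorMainTermExact
import Literature.NumberTheory.LFunctions.NicolasMertensRH
import HarnessLib

/-!
# Under RH the far-coercivity floor law holds with the sharp constant: `λ_max(a) ≤ e^a + 2a − log 4π − γ + o(1)`

Helper file (`--supports stmt-RiemannHypothesis-0098`, lead-track anchor: Weil-positivity window ladder, format-C far bound),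
pure proofs.  Seat rh-explicit-weil-1 gen12 (memo `run/shared/lean/pub/rh-explicit/rh-explicit-weil-1/FORMAT-K3.md` §13).

THE THEOREMS.  `λ_max(a) = farCoercivityFloor a` is the top of the prime-shift form `Q_a` on the `L²`-unit sphere of the window `[−a, a]`
(`WeilFarCoercivityFloor`); `pntFloor a = e^a + 2a − 2 + O(a²e^{−a})` the top eigenvalue of the PNT kernel (`WeilFarFloorMainTermExact`).

* `farCoercivityFloor_le_of_RH_sharp` : under RH, for `a ≥ 4`, `0 < h ≤ ½`, `θ, η ∈ (0, 1]`, `δ > 0` with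
  `4(1 + δ)Ψ(θh/2) ≤ 2(a + sinh a)` (`Ψ = weilArchTail`):
  `λ_max(a) ≤ 2((a + h + h/2) + sinh(a + h + h/2)) − (log 4π + γ) + 2I₀/δ + θ + η`   (`I₀ = ∫₀^∞ (e^{t/2} − 1)/(2 sinh t)`).
* `farCoercivityFloor_le_exp_eventually_of_RH` : **RH → ∀ ε > 0 ∃ a₀ ∀ a ≥ a₀, `λ_max(a) ≤ e^a + 2a − (log 4π + γ) + ε`.**
* `farFloorDiscrepancy_le_eventually_of_RH` : **RH → ∀ ε > 0 ∃ a₀ ∀ a ≥ a₀, `λ_max(a) − (pntFloor a − 2γ) ≤ (2 + γ − log 4π) + ε`** —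
  the UPPER CLAUSE of the floor law C-XIII with the constant `β_F = 2 + γ − log 4π = 0.0461…` (`= Σ_ρ 1/|ρ|²` under RH), matching the
  lower clause `−β_F − o(1) ≤ λ_max(a) − (pntFloor a − 2γ)` of the cosh test (staged `WeilFarFloorCoshZeroSum`); the gen11 route gave `a + 13`.
* `eventually_farFloorDiscrepancy_le_nicolasBeta_of_RH` : the same with Nicolas's `β = nicolasBeta` and the `atTop` filter (the form of the
  lower clause in `WeilFarFloorCoshZeroSum`).
* `exists_farFloor_upper_of_RH` : RH → `∃ C a₀, ∀ a ≥ a₀, λ_max(a) ≤ pntFloor a − 2γ + C` (the upper clause as used in the C-XIII ⟺ RH chain).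

PROOF (`FORMAT-K3` §13).  Every admissible `g` is dominated shift by shift by its box envelope `G` on `[−(a+h), a+h]`, a member of the
linear-modulus class at scale `h/2` with `∫G² = ∫g²` (`WeilFarFloorBoxEnvelope.exists_boxEnvelope`, from `WeilFarFloorEnvelope`); on that
class the RH anatomy SPLIT ALONG THE COSH PROFILE (`WeilFarFloorCoshSplitRH`, `WeilFarFloorModulusClassRH`) gives the ceiling
`2((a + 3h/2) + sinh(·)) + (1 + 1/δ)A − (2I₀ + log 4π + γ) + θ + η` with `A = 2I₀` the cosh profile's own archimedean energy
(`WeilFarFloorCoshProfileEnergy`), so the `2I₀` cancels; `h = εe^{−a}/8`, `θ = η = ε/8`, `δ = 8(2I₀ + 1)/ε` and `e^a ≫_ε a` give the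
asymptotic forms.  Standard axioms only; RH enters as Mathlib's `RiemannHypothesis`.
-/

set_option linter.dupNamespace false
set_option autoImplicit false

noncomputable section

open MeasureTheory Set Filter
open scoped Real Topology

namespace Summit.RiemannHypothesis.RiemannHypothesis.Theorems.WeilFormatC

namespace FloorCoshSplit

open Literature.NumberTheory.LFunctions FloorEnvelope FloorCosh

/-- **The floor under RH, split-envelope form.**  For `a ≥ 4`, `0 < h ≤ ½`, `θ, η ∈ (0,1]`, `δ > 0` with `4(1+δ)Ψ(θh/2) ≤ 2(a + sinh a)`:
`λ_max(a) ≤ 2((a + h + h/2) + sinh(a + h + h/2)) − (log 4π + γ) + 2I₀/δ + θ + η`. -/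
theorem farCoercivityFloor_le_of_RH_sharp (hRH : RiemannHypothesis) {a h θ δ η : ℝ} (ha : 4 ≤ a) (hh0 : 0 < h) (hh1 : h ≤ 1 / 2)
    (hθ0 : 0 < θ) (hθ1 : θ ≤ 1) (hδ : 0 < δ) (hη0 : 0 < η) (hη1 : η ≤ 1)
    (hbig : 4 * (1 + δ) * weilArchTail (θ * (h / 2)) ≤ 2 * (a + Real.sinh a)) :
    farCoercivityFloor a
      ≤ 2 * ((a + h + h / 2) + Real.sinh (a + h + h / 2)) - (Real.log (4 * π) + Real.eulerMascheroniConstant)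
        + 2 * (∫ t in Ioi (0 : ℝ), (Real.exp (t / 2) - 1) / (2 * Real.sinh t)) / δ + θ + η := by
  set I := ∫ t in Ioi (0 : ℝ), (Real.exp (t / 2) - 1) / (2 * Real.sinh t) with hI
  have hI0 : 0 ≤ I := setIntegral_nonneg measurableSet_Ioi fun t ht ↦ weilKillingDensity_nonneg ht
  have ha0 : 0 < a := by linarith
  have hh2 : 0 < h / 2 := by linarith
  have hh21 : h / 2 ≤ 1 := by linarith
  -- the largeness condition on the window `a + h`
  have hbig' : 4 * (1 + δ) * weilArchTail (θ * (h / 2)) ≤ 2 * ((a + h) + Real.sinh (a + h)) := by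
    have : a + Real.sinh a ≤ (a + h) + Real.sinh (a + h) := add_le_add (by linarith) (Real.sinh_le_sinh.2 (by linarith))
    linarith
  -- the cosh profiles' energy on `[a + h, a + h + h/2]`
  have hA : ∀ b' ∈ Icc (a + h) (a + h + h / 2),
      IntegrableOn (fun t ↦ weilArchDensity t
          * ∫ x, ((Icc (-b') b').indicator (fun y ↦ Real.cosh (y / 2)) (x + t)
              - (Icc (-b') b').indicator (fun y ↦ Real.cosh (y / 2)) x) ^ 2) (Ioi (θ * (h / 2))) ∧
        ∫ t in Ioi (θ * (h / 2)), weilArchDensity t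
            * ∫ x, ((Icc (-b') b').indicator (fun y ↦ Real.cosh (y / 2)) (x + t)
                - (Icc (-b') b').indicator (fun y ↦ Real.cosh (y / 2)) x) ^ 2 ≤ 2 * I * (b' + Real.sinh b') := by
    intro b' hb'
    have hθh1 : θ * (h / 2) ≤ 1 := by
      calc θ * (h / 2) ≤ 1 * 1 := mul_le_mul hθ1 hh21 hh2.le zero_le_one
        _ = 1 := one_mul 1
    exact coshProfile_archEnergy_le (by linarith [hb'.1]) (by positivity) hθh1
  refine farCoercivityFloor_le_of_shiftBound ha0 fun g C hgm hC hsupp ↦ ?_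
  obtain ⟨G, hGm, -, hGb, hGs, hGN, hQ, hinc⟩ := exists_boxEnvelope hh0 hgm hC hsupp
  have hceil := primeShiftForm_le_of_RH_of_linearModulus hRH (b := a + h) (h := h / 2) (A := 2 * I) (by linarith) hh2 hh21
    hθ0 hθ1 hδ hη0 hη1 (by positivity) hbig' hA hGm hGb hGs hinc
  rw [hGN] at hceil
  have hN : 0 ≤ ∫ x, g x ^ 2 := integral_nonneg fun x ↦ sq_nonneg _
  have e : 2 * ((a + h + h / 2) + Real.sinh (a + h + h / 2)) + (1 + 1 / δ) * (2 * I)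
        - (2 * I + (Real.log (4 * π) + Real.eulerMascheroniConstant)) + θ + η
      = 2 * ((a + h + h / 2) + Real.sinh (a + h + h / 2)) - (Real.log (4 * π) + Real.eulerMascheroniConstant)
        + 2 * I / δ + θ + η := by
    field_simp; ring
  rw [e] at hceil
  exact hQ.trans hceil

/-- **THE FLOOR LAW UNDER RH WITH THE SHARP CONSTANT**: `RiemannHypothesis → ∀ ε > 0, ∃ a₀, ∀ a ≥ a₀,
λ_max(a) ≤ e^a + 2a − (log 4π + γ) + ε` (`log 4π + γ = 3.108…`; the cosh test gives `λ_max(a) ≥ e^a + 2a − (log 4π + γ) − 2β_F − o(1)`). -/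
theorem farCoercivityFloor_le_exp_eventually_of_RH (hRH : RiemannHypothesis) {ε : ℝ} (hε : 0 < ε) :
    ∃ a₀ : ℝ, ∀ a : ℝ, a₀ ≤ a →
      farCoercivityFloor a ≤ Real.exp a + 2 * a - (Real.log (4 * π) + Real.eulerMascheroniConstant) + ε := by
  set I := ∫ t in Ioi (0 : ℝ), (Real.exp (t / 2) - 1) / (2 * Real.sinh t) with hI
  have hI0 : 0 ≤ I := setIntegral_nonneg measurableSet_Ioi fun t ht ↦ weilKillingDensity_nonneg ht
  -- parameters
  set ε' := min ε 1 with hε'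
  have hε'0 : 0 < ε' := lt_min hε one_pos
  have hε'1 : ε' ≤ 1 := min_le_right _ _
  have hε'ε : ε' ≤ ε := min_le_left _ _
  set θ := ε' / 8 with hθ
  have hθ0 : 0 < θ := by positivity
  have hθ1 : θ ≤ 1 := by rw [hθ]; linarith
  set δ := 8 * (2 * I + 1) / ε' with hδ
  have hδ0 : 0 < δ := by positivity
  have hIδ : 2 * I / δ ≤ ε' / 8 := by
    rw [div_le_iff₀ hδ0, hδ]
    have e : ε' / 8 * (8 * (2 * I + 1) / ε') = 2 * I + 1 := by field_simp
    rw [e]; linarith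
  -- the largeness constants: `4(1+δ)(½(a + L) + 2) ≤ 2(a + sinh a)` for `a ≥ a₀`
  set L := Real.log (256 / ε' ^ 2) with hL
  have hL0 : 0 ≤ L := Real.log_nonneg (by rw [le_div_iff₀ (by positivity)]; nlinarith)
  set a₀ := max 4 (4 * (1 + δ) + 2 * (1 + δ) * (L + 4) + 2) with ha₀
  refine ⟨a₀, fun a ha ↦ ?_⟩
  have ha4 : 4 ≤ a := le_trans (le_max_left _ _) ha
  have haC : 4 * (1 + δ) + 2 * (1 + δ) * (L + 4) + 2 ≤ a := le_trans (le_max_right _ _) ha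
  -- the envelope half-width `h = ε' e^{−a}/8`
  set h := ε' / 8 * Real.exp (-a) with hh
  have hea : Real.exp (-a) ≤ 1 / 16 := by
    have h1 : Real.exp (-a) ≤ Real.exp (-4) := Real.exp_le_exp.2 (by linarith)
    have h2 : Real.exp (-4) * Real.exp 4 = 1 := by rw [← Real.exp_add]; simp
    have h3 : (16 : ℝ) ≤ Real.exp 4 := by
      have he : (2 : ℝ) ≤ Real.exp 1 := by linarith [Real.add_one_le_exp (1 : ℝ)]
      have h4 : Real.exp 4 = Real.exp 1 ^ 4 := by rw [← Real.exp_nat_mul]; norm_num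
      rw [h4]
      have h5 : (4 : ℝ) ≤ Real.exp 1 ^ 2 := by nlinarith
      have h6 := mul_le_mul h5 h5 (by norm_num) (by positivity)
      nlinarith [h6]
    nlinarith [Real.exp_pos (-4)]
  have hh0 : 0 < h := by positivity
  have hh1 : h ≤ 1 / 2 := by rw [hh]; nlinarith
  have hhe : h * Real.exp a = ε' / 8 := by
    rw [hh, mul_assoc, ← Real.exp_add]; simp
  have hhs : h ≤ ε' / 128 := by rw [hh]; nlinarith
  clear_value I ε' θ δ L a₀ h
  -- the largeness condition
  have ht₀ : θ * (h / 2) = ε' ^ 2 / 256 * Real.exp (-a) * 2 := by rw [hθ, hh]; ring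
  have ht₀' : θ * (h / 2) = (ε' ^ 2 / 128) * Real.exp (-a) := by rw [ht₀]; ring
  have ht₀pos : 0 < θ * (h / 2) := by positivity
  have ht₀1 : θ * (h / 2) ≤ 1 := by
    rw [ht₀']
    calc ε' ^ 2 / 128 * Real.exp (-a) ≤ 1 * 1 :=
          mul_le_mul (by nlinarith) (by linarith) (Real.exp_pos _).le zero_le_one
      _ = 1 := one_mul 1
  have hΨ : weilArchTail (θ * (h / 2)) ≤ (1 / 2) * (a + L) + 2 := by
    have h1 := weilArchTail_le_half_log ht₀pos ht₀1
    have h2 : Real.log (1 / (θ * (h / 2))) ≤ a + L := by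
      rw [ht₀', hL]
      have e1 : 1 / (ε' ^ 2 / 128 * Real.exp (-a)) = (128 / ε' ^ 2) * Real.exp a := by
        rw [Real.exp_neg]; field_simp
      rw [e1, Real.log_mul (by positivity) (Real.exp_pos a).ne', Real.log_exp]
      have : Real.log (128 / ε' ^ 2) ≤ Real.log (256 / ε' ^ 2) :=
        Real.log_le_log (by positivity) (div_le_div_of_nonneg_right (by norm_num) (by positivity))
      linarith
    linarith
  have hsinh : a + a ^ 2 / 2 ≤ 2 * Real.sinh a := by
    rw [Real.sinh_eq]
    have h1 := Real.quadratic_le_exp_of_nonneg (by linarith : (0 : ℝ) ≤ a)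
    have h2 : Real.exp (-a) ≤ 1 := Real.exp_le_one_iff.2 (by linarith)
    linarith
  have hbig : 4 * (1 + δ) * weilArchTail (θ * (h / 2)) ≤ 2 * (a + Real.sinh a) := by
    have h1 : 4 * (1 + δ) * weilArchTail (θ * (h / 2)) ≤ 4 * (1 + δ) * ((1 / 2) * (a + L) + 2) :=
      mul_le_mul_of_nonneg_left hΨ (by positivity)
    have h2 : 4 * (1 + δ) * ((1 / 2) * (a + L) + 2) = 2 * (1 + δ) * a + 2 * (1 + δ) * (L + 4) := by ring
    have h3 : 2 * (1 + δ) * a + 2 * (1 + δ) * (L + 4) ≤ a + a ^ 2 / 2 := by nlinarith [haC, hδ0, hL0]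
    linarith
  -- the split-envelope bound and the bookkeeping of the small terms
  have hmain := farCoercivityFloor_le_of_RH_sharp hRH (θ := θ) (δ := δ) (η := θ) ha4 hh0 hh1 hθ0 hθ1 hδ0 hθ0 hθ1 hbig
  rw [← hI] at hmain
  -- `2((a + 3h/2) + sinh(a + 3h/2)) ≤ e^a + 2a + 3h e^a + 3h` with `h e^a = ε'/8`
  have h3h : Real.exp (h + h / 2) ≤ 1 + 3 * h := by
    have hx : |h + h / 2| ≤ 1 := by rw [abs_of_pos (by positivity)]; linarith
    have := Real.abs_exp_sub_one_le hx
    rw [abs_of_pos (by positivity : 0 < h + h / 2)] at this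
    have := (abs_le.1 this).2
    linarith only [this]
  have hexp : Real.exp (a + h + h / 2) ≤ Real.exp a + 3 * (h * Real.exp a) := by
    rw [show a + h + h / 2 = a + (h + h / 2) by ring, Real.exp_add]
    calc Real.exp a * Real.exp (h + h / 2) ≤ Real.exp a * (1 + 3 * h) :=
          mul_le_mul_of_nonneg_left h3h (Real.exp_pos a).le
      _ = Real.exp a + 3 * (h * Real.exp a) := by ring
  have hsinh2 : 2 * Real.sinh (a + h + h / 2) ≤ Real.exp (a + h + h / 2) := by
    rw [Real.sinh_eq]; linarith only [Real.exp_pos (-(a + h + h / 2))]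
  rw [hhe] at hexp
  linarith only [hmain, hexp, hsinh2, hhs, hIδ, hε'ε, hθ, hε'0]

/-- **THE UPPER CLAUSE OF C-XIII UNDER RH, WITH THE CONSTANT `β_F = 2 + γ − log 4π`**:
`RiemannHypothesis → ∀ ε > 0, ∃ a₀, ∀ a ≥ a₀, λ_max(a) − (pntFloor a − 2γ_E) ≤ (2 + γ_E − log 4π) + ε`
(`β_F = 0.0461… = Σ_ρ 1/|ρ|²` under RH; the cosh test shows the residual reaches `−β_F` and `+β_F·(391/392)` infinitely often). -/
theorem farFloorDiscrepancy_le_eventually_of_RH (hRH : RiemannHypothesis) {ε : ℝ} (hε : 0 < ε) :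
    ∃ a₀ : ℝ, ∀ a : ℝ, a₀ ≤ a →
      farCoercivityFloor a - (pntFloor a - 2 * Real.eulerMascheroniConstant)
        ≤ (2 + Real.eulerMascheroniConstant - Real.log (4 * π)) + ε := by
  obtain ⟨a₁, ha₁⟩ := farCoercivityFloor_le_exp_eventually_of_RH hRH (half_pos hε)
  -- `pntFloor a ≥ e^a + 2a − 2 − 14a²e^{−a}` and `14a²e^{−a} ≤ ε/2` for `a` large (`e^a ≥ a⁴/64`)
  set a₀ := max (max a₁ 4) (1792 / ε + 1) with ha₀
  refine ⟨a₀, fun a ha ↦ ?_⟩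
  have ha1 : a₁ ≤ a := le_trans (le_trans (le_max_left _ _) (le_max_left _ _)) ha
  have ha4 : 4 ≤ a := le_trans (le_trans (le_max_right _ _) (le_max_left _ _)) ha
  have haε : 1792 / ε + 1 ≤ a := le_trans (le_max_right _ _) ha
  have hfloor := ha₁ a ha1
  have hpnt := (abs_le.1 (FloorMainTerm.abs_pntFloor_sub_le (a := a) (by linarith))).1
  -- `14 a² e^{−a} ≤ ε/2`
  have hea : Real.exp a ≥ a ^ 4 / 64 := by
    have h1 := Real.quadratic_le_exp_of_nonneg (by linarith : (0 : ℝ) ≤ a / 2)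
    have h2 : Real.exp a = Real.exp (a / 2) ^ 2 := by rw [← Real.exp_nat_mul]; ring_nf
    have h3 : a ^ 2 / 8 ≤ Real.exp (a / 2) := by nlinarith
    rw [h2]; nlinarith [h3]
  have hsmall : 14 * a ^ 2 * Real.exp (-a) ≤ ε / 2 := by
    rw [Real.exp_neg]
    have hapos : 0 < a := by linarith
    have hea' : 0 < Real.exp a := Real.exp_pos a
    rw [show 14 * a ^ 2 * (Real.exp a)⁻¹ = 14 * a ^ 2 / Real.exp a by ring, div_le_iff₀ hea']
    have h1 : 14 * a ^ 2 * 64 ≤ ε / 2 * a ^ 4 := by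
      have h5 : 1792 ≤ ε * a := by
        have := mul_le_mul_of_nonneg_left haε hε.le
        rw [mul_add, mul_div_cancel₀ _ hε.ne', mul_one] at this; linarith
      have h6 : a ^ 2 ≤ a ^ 3 := by nlinarith [sq_nonneg a]
      have h7 := mul_le_mul_of_nonneg_right h5 (by positivity : (0 : ℝ) ≤ a ^ 3)
      nlinarith [h6, h7]
    have h8 := mul_le_mul_of_nonneg_left hea.le (by positivity : (0 : ℝ) ≤ ε / 2)
    nlinarith [h1, h8]
  linarith [hfloor, hpnt, hsmall]

/-- **RH ⟹ eventually `λ_max(a) − (pntFloor a − 2γ_E) ≤ β + ε` with Nicolas's `β = 2 + γ − log π − 2 log 2`** (filter form). -/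
theorem eventually_farFloorDiscrepancy_le_nicolasBeta_of_RH (hRH : RiemannHypothesis) {ε : ℝ} (hε : 0 < ε) :
    ∀ᶠ a : ℝ in atTop,
      farCoercivityFloor a - (pntFloor a - 2 * Real.eulerMascheroniConstant) ≤ nicolasBeta + ε := by
  obtain ⟨a₀, ha₀⟩ := farFloorDiscrepancy_le_eventually_of_RH hRH hε
  have hβ : nicolasBeta = 2 + Real.eulerMascheroniConstant - Real.log (4 * π) := by
    unfold nicolasBeta
    rw [Real.log_mul (by norm_num) Real.pi_pos.ne', show (4 : ℝ) = 2 ^ 2 by norm_num, Real.log_pow]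
    push_cast; ring
  rw [hβ]
  exact Filter.eventually_atTop.2 ⟨a₀, ha₀⟩

/-- **RH ⟹ the upper clause of the floor law**: `∃ C a₀, ∀ a ≥ a₀, λ_max(a) ≤ pntFloor a − 2γ_E + C` (here `C = β_F + 1`). -/
theorem exists_farFloor_upper_of_RH (hRH : RiemannHypothesis) :
    ∃ C a₀ : ℝ, ∀ a : ℝ, a₀ ≤ a → farCoercivityFloor a ≤ pntFloor a - 2 * Real.eulerMascheroniConstant + C := by
  obtain ⟨a₀, ha₀⟩ := farFloorDiscrepancy_le_eventually_of_RH hRH one_pos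
  exact ⟨(2 + Real.eulerMascheroniConstant - Real.log (4 * π)) + 1, a₀, fun a ha ↦ by linarith [ha₀ a ha]⟩

end FloorCoshSplit

end Summit.RiemannHypothesis.RiemannHypothesis.Theorems.WeilFormatC
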